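import Mathlib
import HarnessLib
import Literature.MathematicalPhysics.StatisticalMechanics.MuGSC
import Literature.MathematicalPhysics.StatisticalMechanics.LennardJonesClusters
import Summits.AtomisticToContinuum.Crystallization.Theses.OverbindingBudget
import Summits.AtomisticToContinuum.Crystallization.Theorems.OverbindingBudgetCubeBookkeeping
import Summits.AtomisticToContinuum.Crystallization.Theorems.OverbindingBudgetCubeTails

/-!
# OverbindingBudget — `CubeChargeLaw` (stmt-AtomisticToContinuum-30251) via the line «Bookkeeping»

The last registered stub of the line «Bookkeeping» (skeleton `Cruxes/CubeChargeLaw/Lines/birth.lean`; the other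
three, `stub_siteSumSplit`, `stub_pairSumLowerBound`, `stub_removalUpperBound`, are landed in
`Theorems/OverbindingBudgetCubeBookkeeping.lean`) and the item itself:

* `stub_crossTermSmall` — the cross field is `o(ℓ³)` uniformly in the cube position: deep sites see the complement
  at distance `≥ R` (field `≤ G R⁻³` by dyadic shell counting), shallow sites lie in six slabs `ℓ × ℓ × R`
  (`card_slab_le`) and have field `≤ G δ⁻³`; `R ≥ 54 G δ⁻³/η`, `ℓ ≥ 324 R δ⁻³ B/η`;
* `cubeChargeLaw : CubeChargeLaw` — the composition (`|∑_F (φ − 2e)| ≤ |cross| ≤ η ℓ³`).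
-/

namespace Summit.AtomisticToContinuum.Crystallization.Theorems.OverbindingBudgetCubeChargeLaw

open Literature.MathematicalPhysics.StatisticalMechanics
open Summit.AtomisticToContinuum.Crystallization.Theorems.OverbindingBudgetCubeTails
open Summit.AtomisticToContinuum.Crystallization.Theorems.OverbindingBudgetCubeBookkeeping
  (stub_siteSumSplit stub_pairSumLowerBound stub_removalUpperBound)

/-- Registered stub `stub_crossTermSmall` of the line «Bookkeeping» (CubeChargeLaw, stmt-30251): the cross field
between a large cube and its complement is `o(ℓ³)`, uniformly in the cube position. [folklore] -/
theorem stub_crossTermSmall : ∀ Y : Set (EuclideanSpace ℝ (Fin 3)), Literature.MathematicalPhysics.StatisticalMechanics.UniformlyDiscrete Y → ∀ η : ℝ, 0 < η → ∃ ℓ₀ : ℝ, ∀ ℓ : ℝ, ∀ c : EuclideanSpace ℝ (Fin 3), ℓ₀ ≤ ℓ → ∀ F : Finset (EuclideanSpace ℝ (Fin 3)), (↑F : Set (EuclideanSpace ℝ (Fin 3))) = Y ∩ {z | ∀ i : Fin 3, c i ≤ z i ∧ z i < c i + ℓ} → |∑ y ∈ F, ∑' w : ↥(Y \ ↑F), Literature.MathematicalPhysics.StatisticalMechanics.lennardJones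 (dist y (w : EuclideanSpace ℝ (Fin 3)))| ≤ η * ℓ ^ 3 := by
  intro Y hUD η hη
  classical
  obtain ⟨δ, hδ, hsep⟩ := id hUD
  -- constants
  set G : ℝ := 432 * (δ⁻¹ ^ 6 + 1) * δ⁻¹ ^ 3 with hG
  have hG0 : 0 ≤ G := by positivity
  set B : ℝ := G * δ⁻¹ ^ 3 with hB
  have hB0 : 0 ≤ B := by positivity
  set R : ℝ := max (max 1 δ) (54 * G * δ⁻¹ ^ 3 / η) with hR
  have hR1 : max 1 δ ≤ R := le_max_left _ _
  have hR1' : 1 ≤ R := (le_max_left _ _).trans hR1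
  have hRδ : δ ≤ R := (le_max_right _ _).trans hR1
  have hR0 : 0 < R := by linarith
  have hRη : 54 * G * δ⁻¹ ^ 3 / η ≤ R := le_max_right _ _
  refine ⟨max (max 1 δ) (324 * R * δ⁻¹ ^ 3 * B / η), fun ℓ c hℓ F hF => ?_⟩
  have hℓ1 : 1 ≤ ℓ := ((le_max_left _ _).trans (le_max_left _ _)).trans hℓ
  have hℓδ : δ ≤ ℓ := ((le_max_right _ _).trans (le_max_left _ _)).trans hℓ
  have hℓ0 : 0 < ℓ := by linarith
  have hℓB : 324 * R * δ⁻¹ ^ 3 * B / η ≤ ℓ := (le_max_right _ _).trans hℓ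
  -- membership facts
  have hFY : (↑F : Set (EuclideanSpace ℝ (Fin 3))) ⊆ Y := by
    rw [hF]; exact Set.inter_subset_left
  have hFcube : ∀ z ∈ F, ∀ i, c i ≤ z i ∧ z i < c i + ℓ := by
    intro z hz
    have hz' : z ∈ (↑F : Set (EuclideanSpace ℝ (Fin 3))) := Finset.mem_coe.2 hz
    rw [hF] at hz'
    exact hz'.2
  have hout : ∀ w ∈ Y \ (↑F : Set (EuclideanSpace ℝ (Fin 3))), ∃ i, w i < c i ∨ c i + ℓ ≤ w i := by
    intro w hw
    by_contra h
    push Not at h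
    have hw' : w ∈ (↑F : Set (EuclideanSpace ℝ (Fin 3))) := by
      rw [hF]; exact ⟨hw.1, h⟩
    exact hw.2 hw'
  have hTsep : ∀ z ∈ Y \ (↑F : Set (EuclideanSpace ℝ (Fin 3))), ∀ w ∈ Y \ (↑F : Set (EuclideanSpace ℝ (Fin 3))), z ≠ w → δ ≤ dist z w :=
    fun z hz w hw hzw => hsep z hz.1 w hw.1 hzw
  -- the site tails
  set T : EuclideanSpace ℝ (Fin 3) → ℝ := fun y => ∑' w : ↥(Y \ ↑F), lennardJones (dist y (w : EuclideanSpace ℝ (Fin 3))) with hT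
  have hcrude : ∀ y ∈ F, |T y| ≤ B := by
    intro y hy
    have hyY : y ∈ Y := hFY (Finset.mem_coe.2 hy)
    have h := abs_tsum_lennardJones_le_dyadic (T := Y \ ↑F) y hδ le_rfl
      (fun z hz => hsep y hyY z hz.1 (fun hyz => hz.2 (hyz ▸ (Finset.mem_coe.2 hy)))) hTsep
    simpa only [hB, hG] using h
  have hfar : ∀ y ∈ F, (∀ i, c i + R ≤ y i ∧ y i < c i + ℓ - R) → |T y| ≤ G * R⁻¹ ^ 3 := by
    intro y hy hint
    have h := abs_tsum_lennardJones_le_dyadic (T := Y \ ↑F) y hδ hRδ (fun w hw => ?far) hTsep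
    · simpa only [hG] using h
    case far =>
      obtain ⟨i, hi⟩ := hout w hw
      have hci := hint i
      have hcoord : R ≤ |y i - w i| := by
        rcases hi with h | h
        · rw [abs_of_nonneg (by linarith [hci.1])]
          linarith [hci.1]
        · rw [abs_of_nonpos (by linarith [hci.2])]
          linarith [hci.2]
      exact hcoord.trans (le_of_eq_of_le (Real.dist_eq (y i) (w i)).symm (PiLp.dist_apply_le y w i))
  -- splitting the sites into deep and shallow ones
  set P : EuclideanSpace ℝ (Fin 3) → Prop := fun y => ∀ i, c i + R ≤ y i ∧ y i < c i + ℓ - R with hP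
  have habs : |∑ y ∈ F, T y| ≤ ∑ y ∈ F, |T y| := Finset.abs_sum_le_sum_abs _ _
  have hsum : ∑ y ∈ F, |T y| =
      ∑ y ∈ F.filter P, |T y| + ∑ y ∈ F.filter (fun y => ¬ P y), |T y| :=
    (Finset.sum_filter_add_sum_filter_not F P _).symm
  have hint : ∑ y ∈ F.filter P, |T y| ≤ (F.filter P).card * (G * R⁻¹ ^ 3) := by
    have h := Finset.sum_le_sum (fun y hy => hfar y (Finset.mem_filter.1 hy).1 (Finset.mem_filter.1 hy).2)
    rwa [Finset.sum_const, nsmul_eq_mul] at h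
  have hlay : ∑ y ∈ F.filter (fun y => ¬ P y), |T y| ≤ (F.filter (fun y => ¬ P y)).card * B := by
    have h : ∑ y ∈ F.filter (fun y => ¬ P y), |T y| ≤ ∑ _y ∈ F.filter (fun y => ¬ P y), B :=
      Finset.sum_le_sum (fun y hy => hcrude y (Finset.mem_filter.1 hy).1)
    rwa [Finset.sum_const, nsmul_eq_mul] at h
  -- counting: all sites
  have hcardP : ((F.filter P).card : ℝ) ≤ F.card := by exact_mod_cast Finset.card_filter_le _ _
  have hFle : (F.card : ℝ) ≤ (2 * ℓ / δ + 1) ^ 3 := by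
    have h := card_le_of_separated_of_box F (fun i => c i) (fun _ => ℓ) hδ (fun _ => hℓ0.le)
      (fun z hz i => hFcube z hz i)
      (fun z hz w hw hzw => hsep z (hFY (Finset.mem_coe.2 hz)) w (hFY (Finset.mem_coe.2 hw)) hzw)
    simpa [Finset.prod_const, Finset.card_univ, Fintype.card_fin] using h
  -- counting: shallow sites lie in six slabs
  set Sm : Fin 3 → Finset (EuclideanSpace ℝ (Fin 3)) := fun i => F.filter (fun z => z i < c i + R) with hSm
  set Sp : Fin 3 → Finset (EuclideanSpace ℝ (Fin 3)) := fun i => F.filter (fun z => c i + ℓ - R ≤ z i) with hSp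
  have hsub : F.filter (fun y => ¬ P y) ⊆ Finset.univ.biUnion (fun i => Sm i ∪ Sp i) := by
    intro z hz
    rw [Finset.mem_filter] at hz
    obtain ⟨hzF, hnP⟩ := hz
    have hnP' : ∃ i, z i < c i + R ∨ c i + ℓ - R ≤ z i := by
      by_contra h
      push Not at h
      exact hnP h
    obtain ⟨i, hi⟩ := hnP'
    rw [Finset.mem_biUnion]
    refine ⟨i, Finset.mem_univ _, ?_⟩
    rw [Finset.mem_union]
    rcases hi with h | h
    · left
      exact Finset.mem_filter.2 ⟨hzF, h⟩
    · right
      exact Finset.mem_filter.2 ⟨hzF, h⟩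
  have hSm_le : ∀ i, ((Sm i).card : ℝ) ≤ (2 * R / δ + 1) * (2 * ℓ / δ + 1) ^ 2 := by
    intro i
    exact card_slab_le (Sm i) c ℓ R (c i) i hδ hℓ0.le hR0.le
      (fun z hz j => hFcube z (Finset.mem_filter.1 hz).1 j)
      (fun z hz => ⟨(hFcube z (Finset.mem_filter.1 hz).1 i).1, (Finset.mem_filter.1 hz).2⟩)
      (fun z hz w hw hzw => hsep z (hFY (Finset.mem_coe.2 (Finset.mem_filter.1 hz).1)) w
        (hFY (Finset.mem_coe.2 (Finset.mem_filter.1 hw).1)) hzw)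
  have hSp_le : ∀ i, ((Sp i).card : ℝ) ≤ (2 * R / δ + 1) * (2 * ℓ / δ + 1) ^ 2 := by
    intro i
    exact card_slab_le (Sp i) c ℓ R (c i + ℓ - R) i hδ hℓ0.le hR0.le
      (fun z hz j => hFcube z (Finset.mem_filter.1 hz).1 j)
      (fun z hz => ⟨(Finset.mem_filter.1 hz).2, by
        have := (hFcube z (Finset.mem_filter.1 hz).1 i).2; linarith⟩)
      (fun z hz w hw hzw => hsep z (hFY (Finset.mem_coe.2 (Finset.mem_filter.1 hz).1)) w
        (hFY (Finset.mem_coe.2 (Finset.mem_filter.1 hw).1)) hzw)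
  have hlayer : ((F.filter (fun y => ¬ P y)).card : ℝ) ≤ 6 * ((2 * R / δ + 1) * (2 * ℓ / δ + 1) ^ 2) := by
    calc ((F.filter (fun y => ¬ P y)).card : ℝ)
        ≤ ((Finset.univ.biUnion (fun i => Sm i ∪ Sp i)).card : ℝ) := by
          exact_mod_cast Finset.card_le_card hsub
      _ ≤ ∑ i, ((Sm i ∪ Sp i).card : ℝ) := by
          exact_mod_cast Finset.card_biUnion_le
      _ ≤ ∑ i, (((Sm i).card : ℝ) + (Sp i).card) :=
          Finset.sum_le_sum (fun i _ => by exact_mod_cast Finset.card_union_le _ _)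
      _ ≤ ∑ _i : Fin 3, 2 * ((2 * R / δ + 1) * (2 * ℓ / δ + 1) ^ 2) :=
          Finset.sum_le_sum (fun i _ => by linarith [hSm_le i, hSp_le i])
      _ = 6 * ((2 * R / δ + 1) * (2 * ℓ / δ + 1) ^ 2) := by
          simp only [Finset.sum_const, Finset.card_univ, Fintype.card_fin, nsmul_eq_mul]
          push_cast
          ring
  -- arithmetic
  have hu0 : 0 < δ⁻¹ := inv_pos.2 hδ
  have hv0 : 0 < R⁻¹ := inv_pos.2 hR0
  have hv1 : R⁻¹ ≤ 1 := inv_le_one_of_one_le₀ hR1'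
  have hℓu : 1 ≤ ℓ * δ⁻¹ := by
    rw [← div_eq_mul_inv, le_div_iff₀ hδ]; linarith
  have hRu : 1 ≤ R * δ⁻¹ := by
    rw [← div_eq_mul_inv, le_div_iff₀ hδ]; linarith
  have hA0 : 0 ≤ G * R⁻¹ ^ 3 := by positivity
  -- (2ℓ/δ + 1)³ ≤ 27 ℓ³ δ⁻³ and the slab bound ≤ 27 R ℓ² δ⁻³
  have h2ℓ : 2 * ℓ / δ + 1 ≤ 3 * (ℓ * δ⁻¹) := by rw [div_eq_mul_inv]; linarith
  have h2R : 2 * R / δ + 1 ≤ 3 * (R * δ⁻¹) := by rw [div_eq_mul_inv]; linarith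
  have h2ℓ0 : 0 ≤ 2 * ℓ / δ + 1 := by positivity
  have h2R0 : 0 ≤ 2 * R / δ + 1 := by positivity
  have hcube3 : (2 * ℓ / δ + 1) ^ 3 ≤ (3 * (ℓ * δ⁻¹)) ^ 3 := pow_le_pow_left₀ h2ℓ0 h2ℓ 3
  have hslab3 : (2 * R / δ + 1) * (2 * ℓ / δ + 1) ^ 2 ≤ (3 * (R * δ⁻¹)) * (3 * (ℓ * δ⁻¹)) ^ 2 :=
    mul_le_mul h2R (pow_le_pow_left₀ h2ℓ0 h2ℓ 2) (by positivity) (by positivity)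
  -- first half: deep sites
  have hkey1 : 54 * G * δ⁻¹ ^ 3 * R⁻¹ ≤ η := by
    have h := hRη
    rw [div_le_iff₀ hη] at h
    have hR' : R ≠ 0 := hR0.ne'
    calc 54 * G * δ⁻¹ ^ 3 * R⁻¹ ≤ R * η * R⁻¹ := by gcongr
      _ = η := by field_simp
  have hv3 : R⁻¹ ^ 3 ≤ R⁻¹ := pow_le_of_le_one hv0.le hv1 (by norm_num)
  have hdeep : (F.card : ℝ) * (G * R⁻¹ ^ 3) ≤ η / 2 * ℓ ^ 3 := by
    calc (F.card : ℝ) * (G * R⁻¹ ^ 3)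
        ≤ (3 * (ℓ * δ⁻¹)) ^ 3 * (G * R⁻¹ ^ 3) :=
          mul_le_mul_of_nonneg_right (hFle.trans hcube3) hA0
      _ = ℓ ^ 3 * (27 * G * δ⁻¹ ^ 3 * R⁻¹ ^ 3) := by ring
      _ ≤ ℓ ^ 3 * (27 * G * δ⁻¹ ^ 3 * R⁻¹) := by
          apply mul_le_mul_of_nonneg_left _ (by positivity)
          exact mul_le_mul_of_nonneg_left hv3 (by positivity)
      _ ≤ ℓ ^ 3 * (η / 2) := by
          apply mul_le_mul_of_nonneg_left _ (by positivity)
          linarith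
      _ = η / 2 * ℓ ^ 3 := by ring
  -- second half: shallow sites
  have hkey2 : 324 * R * δ⁻¹ ^ 3 * B ≤ ℓ * η := by
    have h := hℓB
    rwa [div_le_iff₀ hη] at h
  have hshallow : ((F.filter (fun y => ¬ P y)).card : ℝ) * B ≤ η / 2 * ℓ ^ 3 := by
    calc ((F.filter (fun y => ¬ P y)).card : ℝ) * B
        ≤ 6 * ((3 * (R * δ⁻¹)) * (3 * (ℓ * δ⁻¹)) ^ 2) * B := by
          apply mul_le_mul_of_nonneg_right _ hB0
          exact hlayer.trans (by linarith [hslab3])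
      _ = ℓ ^ 2 * (324 * R * δ⁻¹ ^ 3 * B) / 2 := by ring
      _ ≤ ℓ ^ 2 * (ℓ * η) / 2 := by gcongr
      _ = η / 2 * ℓ ^ 3 := by ring
  -- conclusion
  calc |∑ y ∈ F, T y| ≤ ∑ y ∈ F, |T y| := habs
    _ = ∑ y ∈ F.filter P, |T y| + ∑ y ∈ F.filter (fun y => ¬ P y), |T y| := hsum
    _ ≤ (F.filter P).card * (G * R⁻¹ ^ 3) + (F.filter (fun y => ¬ P y)).card * B :=
        add_le_add hint hlay
    _ ≤ (F.card : ℝ) * (G * R⁻¹ ^ 3) + (F.filter (fun y => ¬ P y)).card * B := by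
        gcongr
    _ ≤ η / 2 * ℓ ^ 3 + η / 2 * ℓ ^ 3 := add_le_add hdeep hshallow
    _ = η * ℓ ^ 3 := by ring

/-- **`CubeChargeLaw`** (support item stmt-AtomisticToContinuum-30251 of route `OverbindingBudget`): in every
μGSC(e) `Y ⊆ ℝ³` with `e ≤ E(N)/N` for all `N`, the total site charge `∑_{y ∈ F} (φ_Y(y) − 2e)` of a large cube
`F = Y ∩ Q(c, ℓ)` is `o(ℓ³)` — the composition `CubeChargeLaw_of` of the registered line «Bookkeeping».
[cite: Suto2006, §2 (μGSC removal test); BlancLewin2015, §1.1] -/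
theorem cubeChargeLaw : Summit.AtomisticToContinuum.Crystallization.Theses.OverbindingBudget.CubeChargeLaw := by
  intro e he Y hUD hμ η hη
  obtain ⟨ℓ₀, hℓ₀⟩ := stub_crossTermSmall Y hUD η hη
  refine ⟨ℓ₀, fun ℓ c hℓ F hF => ?_⟩
  have hFY : (↑F : Set (EuclideanSpace ℝ (Fin 3))) ⊆ Y := by
    rw [hF]; exact Set.inter_subset_left
  have hX := hℓ₀ ℓ c hℓ F hF
  have hD := stub_pairSumLowerBound e he F
  have hR := stub_removalUpperBound e Y hUD hμ F hFY
  have hφ : ∑ y ∈ F, ((∑' w : ↥Y, lennardJones (dist y (w : EuclideanSpace ℝ (Fin 3)))) - 2 * e) =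
      (∑ y ∈ F, ∑ w ∈ F, lennardJones (dist y w)) +
        (∑ y ∈ F, ∑' w : ↥(Y \ ↑F), lennardJones (dist y (w : EuclideanSpace ℝ (Fin 3)))) -
          2 * e * (F.card : ℝ) := by
    rw [Finset.sum_sub_distrib, Finset.sum_const, nsmul_eq_mul,
      Finset.sum_congr rfl (fun y _ => stub_siteSumSplit Y hUD F hFY y), Finset.sum_add_distrib]
    ring
  rw [hφ]
  rw [abs_le] at hX ⊢
  constructor <;> linarith [hX.1, hX.2]

end Summit.AtomisticToContinuum.Crystallization.Theorems.OverbindingBudgetCubeChargeLaw
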